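import Summits.HodgeConjecture.HodgeConjecture.Theorems.Ring2AtlasOpenCells
import Summits.HodgeConjecture.HodgeConjecture.Theorems.Ring2DeformClassTargets
import Summits.HodgeConjecture.HodgeConjecture.Theorems.Ring2ClassTargets
import Summits.HodgeConjecture.HodgeConjecture.Theorems.Ring2HypothesesCMPowerAnchors
import Literature.AlgebraicGeometry.HodgeTheory.SimplePrimeDimensionHodgeClasses
import Literature.AlgebraicGeometry.HodgeTheory.MaximalPicardNumberHodgeClasses
import HarnessLib

/-!
# Ring 2 · deform axis, part VIII — the localised row U on the TYPED ATLAS CELLS, and the free CM anchors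

HONEST FRAMING (cell `pub-hodge-ring2`, verbatim): research route conditional on HC_CM; not a corollary;
Q11.4-sentence-2 already refuted in dim ≥ 3.

`HC_CM` := `Theses.RankFourFaces.CMAbelianHodge` (stmt-HodgeConjecture-3052) is a HYPOTHESIS `(hCM : …)` wherever it
occurs below, never a cited fact; `HC_AV` := `Theses.PadicSemiregularLift.HodgeAbelianVarieties`
(stmt-HodgeConjecture-1333); the item served is stmt-HodgeConjecture-16267 (`Theses.RankFourFaces.CMToAbelian`), as a
helper. Fact #20 := `Literature.AlgebraicGeometry.Deligne1982.deligne1982_cmDenseMumfordTateFamilies` (a hypothesis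
`(hF : …)` here, exactly as in part VII).

WHAT THIS PART ADDS (theorems only; no definition, no new `@[conjecture]` node, no `sorry`).

§1 BY-NAME TWINS. Part VII (`Ring2DeformClassTargets`) proved, per abelian variety, the exactness
`HC(A) ↔ CMSpreadingAt A` modulo `HC_CM` + #20 (`hodgeConjectureFor_iff_cmSpreadingAt_of_HC_CM`), where
`CMSpreadingAt A` is row U of the axis ("algebraicity spreads from the CM fibres of every admissible CM-dense family
through `A` to the fibre `A`") read at `A`. Here that exactness is instantiated BY NAME on the five typed open cells of
the atlas (`Ring2.Atlas.*`, `Theorems/Ring2AtlasOpenCells.lean`) and on typer 1's class targets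
(`Ring2.ClassTargets.HCOnClass / HCAtDim / HCUpToDim`, `Theorems/Ring2ClassTargets.lean`): for each cell `𝒞`,
`𝒞 ↔ (localised row U on the members of 𝒞)` given `hCM`, `hF`, and the unconditional on-path direction
`𝒞 → (localised row U on 𝒞)`. These are the atlas columns (c6)/(c7) of `AV-HODGE-ATLAS.md` in kernel form.

§2 A CELL WHERE ROW U IS A THEOREM. On the discriminant-1 Weil sub-cell the localised row U is DISCHARGED modulo the
refereed named fact Floccari–Fu 2026 Thm. 1.2 (`FloccariFu2026_hodgeClasses_algebraic_powers_discOneWeilFourfold`):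
`cmSpreadingAt_powSucc_discOneWeilFourfold_of_floccariFu`. First non-CM, non-divisor-generated cell of the atlas on
which the deformation input is not an open statement.

§3 FREE CM ANCHORS (RING2-MAP §deform gen 11, D.37). The CM points of the two `EXPECTED` cells of D.34 are anchors
WITHOUT `HC_CM`: every abelian variety isogenous to a power `E^{N+1}` of a CM elliptic curve (the `E_{k'}^6` fibres of the
`k E₀` Weil `(2,1),(1,2)` families; tree theorem `EllipticCurve.hodgeConjectureFor_of_isIsogenous_powSucc_of_cm`), and —
modulo the refereed named fact Tankeev–Ribet (`TankeevRibet1983_hodgeClasses_divisorial_powers_simplePrimeDimension`,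
prime `2`) — every abelian variety isogenous to a power `B^{N+1}` of a SIMPLE CM abelian surface (the `B²` fibres of the
type III(1) Shimura curves at cyclic / non-Galois quartic CM points). Family form: such fibres lie in part V's
`anchorLocus`.

All statements keep `HC_CM` as the binder `hCM`; nothing here decides `HC_CM`, `HC_AV` or any cell.

Sources: [Deligne 1982, §5 Thm. 5.3, §6 Prop. 6.1, Thm. 2.11]; [Charles–Schnell 2014 = arXiv:1101.3647, Thm. 11.5.11,
Prop. 11.3.11]; [Floccari–Fu 2026, JMPA 210, Thm. 1.2 = arXiv:2504.13607]; [van Geemen 1994, LNM 1594, Lemma 3.7,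
Thm. 4.3, 4.13]; [Moonen–Zarhin 1999 = arXiv:math/9901113, Thm. (2.7)]; [Abdulali 2002 = arXiv:math/0410024, Thm. 4.1,
Cor. 4.3]; [Abdulali 2016, LMS LN 427, Appendix A items 2(a), 3(b), 3(c)]; [Deligne 2000, §1].
-/

set_option linter.dupNamespace false

noncomputable section

namespace Summit.HodgeConjecture.HodgeConjecture.Ring2.Deform

open CategoryTheory AlgebraicGeometry
open Literature.AlgebraicGeometry Literature.AlgebraicGeometry.Motives
open Literature.AlgebraicGeometry.HodgeTheory
open Literature.AlgebraicTopology.SingularHomology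
open Literature.AlgebraicGeometry.Deligne1982 (deligne1982_cmDenseMumfordTateFamilies)
open Summit.HodgeConjecture.HodgeConjecture
open Summit.HodgeConjecture.HodgeConjecture.Theses
open Summit.HodgeConjecture.HodgeConjecture.Ring2.Hypotheses (anchorLocus mem_anchorLocus_of_chart)

/-! ## §1 The five typed open cells of the atlas: `cell ↔ localised row U on the cell` (mod `HC_CM` + #20) -/

/-- **Cell g4.Mumford × powers.** Modulo `HC_CM` (binder) and #20, HC for the powers `A^{N+1}` (`N ≥ 1`) of a
Mumford-type fourfold is EXACTLY the localised row U at those powers. [cite: Deligne1982HodgeCycles, §6 Prop. 6.1]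
[cite: CharlesSchnell2014Notes, Thm. 11.5.11, Prop. 11.3.11] -/
theorem hodgePowersOfMumfordTypeFourfold_iff_cmSpreading_of_HC_CM (hCM : RankFourFaces.CMAbelianHodge)
    (hF : deligne1982_cmDenseMumfordTateFamilies) :
    Atlas.HodgePowersOfMumfordTypeFourfold ↔
      ∀ (A : AbelianVariety ℂ), A.dim = 4 → Module.finrank ℚ A.endAlgebra = 1 →
        ∀ N : ℕ, 0 < N → CMSpreadingAt (A.powSucc N) :=
  ⟨fun h A hA hE N hN ↦ cmSpreadingAt_of_hodgeConjectureFor (h A hA hE N hN),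
    fun h A hA hE N hN ↦ hodgeConjectureFor_of_HC_CM_of_cmSpreadingAt hCM hF (h A hA hE N hN)⟩

/-- ON-PATH, unconditionally: the Mumford cell gives the localised row U on its members. [cite: Deligne2000, §1] -/
theorem cmSpreading_of_hodgePowersOfMumfordTypeFourfold (h : Atlas.HodgePowersOfMumfordTypeFourfold) :
    ∀ (A : AbelianVariety ℂ), A.dim = 4 → Module.finrank ℚ A.endAlgebra = 1 →
      ∀ N : ℕ, 0 < N → CMSpreadingAt (A.powSucc N) :=
  fun A hA hE N hN ↦ cmSpreadingAt_of_hodgeConjectureFor (h A hA hE N hN)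

/-- **Cell g4.Weil × powers.** Modulo `HC_CM` (binder) and #20, HC for all powers of a Weil-type fourfold with
`(2,2)` Weil classes is EXACTLY the localised row U at those powers. [cite: Deligne1982HodgeCycles, §6 Prop. 6.1]
[cite: CharlesSchnell2014Notes, Thm. 11.5.11, Prop. 11.3.11] -/
theorem hodgePowersOfWeilTypeFourfold_iff_cmSpreading_of_HC_CM (hCM : RankFourFaces.CMAbelianHodge)
    (hF : deligne1982_cmDenseMumfordTateFamilies) :
    Atlas.HodgePowersOfWeilTypeFourfold ↔
      ∀ (A : AbelianVariety ℂ) (φ : A ⟶ A) (d : ℕ), 0 < d → A.dim = 4 → φ ≫ φ = -(d • 𝟙 A) →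
        (∀ c ∈ weilClassesOf A φ 2 d, IsOfHodgeType 4 A.X 4 2 2 c) →
        ∀ N : ℕ, CMSpreadingAt (A.powSucc N) :=
  ⟨fun h A φ d hd hA hφ hW N ↦ cmSpreadingAt_of_hodgeConjectureFor (h A φ d hd hA hφ hW N),
    fun h A φ d hd hA hφ hW N ↦ hodgeConjectureFor_of_HC_CM_of_cmSpreadingAt hCM hF (h A φ d hd hA hφ hW N)⟩

/-- ON-PATH, unconditionally: the Weil cell gives the localised row U on its members. [cite: Deligne2000, §1] -/
theorem cmSpreading_of_hodgePowersOfWeilTypeFourfold (h : Atlas.HodgePowersOfWeilTypeFourfold) :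
    ∀ (A : AbelianVariety ℂ) (φ : A ⟶ A) (d : ℕ), 0 < d → A.dim = 4 → φ ≫ φ = -(d • 𝟙 A) →
      (∀ c ∈ weilClassesOf A φ 2 d, IsOfHodgeType 4 A.X 4 2 2 c) →
      ∀ N : ℕ, CMSpreadingAt (A.powSucc N) :=
  fun A φ d hd hA hφ hW N ↦ cmSpreadingAt_of_hodgeConjectureFor (h A φ d hd hA hφ hW N)

/-- **Sub-cell g4.Weil.δ=1 × powers.** Modulo `HC_CM` (binder) and #20, HC for all powers of a discriminant-1
Weil-type fourfold is EXACTLY the localised row U at those powers (§2: there it is moreover a THEOREM modulo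
Floccari–Fu). [cite: Deligne1982HodgeCycles, §6 Prop. 6.1] [cite: FloccariFu2026, Theorem 1.2] -/
theorem hodgePowersOfDiscOneWeilFourfold_iff_cmSpreading_of_HC_CM (hCM : RankFourFaces.CMAbelianHodge)
    (hF : deligne1982_cmDenseMumfordTateFamilies) :
    Atlas.HodgePowersOfDiscOneWeilFourfold ↔
      ∀ (A : AbelianVariety ℂ) (φ : A ⟶ A) (d : ℕ), 0 < d → A.dim = 4 → φ ≫ φ = -(d • 𝟙 A) →
        ∀ (e : ProjectiveEmbedding A.X) (a : complexBetti (projectiveSpace e.n ℂ) 2), IsRationalClass a → a ≠ 0 →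
        IsHyperbolicWeilType A φ 2
          ((d : ℂ) • complexBetti.map e.ι 2 a + complexBetti.map φ.hom.hom.hom 2 (complexBetti.map e.ι 2 a)) →
        ∀ N : ℕ, CMSpreadingAt (A.powSucc N) :=
  ⟨fun h A φ d hd hA hφ e a ha ha0 hyp N ↦ cmSpreadingAt_of_hodgeConjectureFor (h A φ d hd hA hφ e a ha ha0 hyp N),
    fun h A φ d hd hA hφ e a ha ha0 hyp N ↦
      hodgeConjectureFor_of_HC_CM_of_cmSpreadingAt hCM hF (h A φ d hd hA hφ e a ha ha0 hyp N)⟩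

/-- **Cell g4.III(1) × powers.** Modulo `HC_CM` (binder) and #20, HC for all powers of a simple fourfold of Weil
type with non-commutative endomorphisms (type III(1)) is EXACTLY the localised row U at those powers. Its CM fibres
are free anchors (§3; RING2-MAP D.37). [cite: Deligne1982HodgeCycles, §6 Prop. 6.1] [cite: Abdulali2002TypeIII, Thm. 4.1] -/
theorem hodgePowersOfTypeIIIFourfold_iff_cmSpreading_of_HC_CM (hCM : RankFourFaces.CMAbelianHodge)
    (hF : deligne1982_cmDenseMumfordTateFamilies) :
    Atlas.HodgePowersOfTypeIIIFourfold ↔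
      ∀ (A : AbelianVariety ℂ) (φ : A ⟶ A) (d : ℕ), 0 < d → A.dim = 4 → φ ≫ φ = -(d • 𝟙 A) →
        (∀ c ∈ weilClassesOf A φ 2 d, IsOfHodgeType 4 A.X 4 2 2 c) →
        A.IsSimple → (∃ ψ χ : A ⟶ A, ψ ≫ χ ≠ χ ≫ ψ) →
        ∀ N : ℕ, CMSpreadingAt (A.powSucc N) :=
  ⟨fun h A φ d hd hA hφ hW hs hnc N ↦ cmSpreadingAt_of_hodgeConjectureFor (h A φ d hd hA hφ hW hs hnc N),
    fun h A φ d hd hA hφ hW hs hnc N ↦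
      hodgeConjectureFor_of_HC_CM_of_cmSpreadingAt hCM hF (h A φ d hd hA hφ hW hs hnc N)⟩

/-- ON-PATH, unconditionally: the type III(1) cell gives the localised row U on its members. [cite: Deligne2000, §1] -/
theorem cmSpreading_of_hodgePowersOfTypeIIIFourfold (h : Atlas.HodgePowersOfTypeIIIFourfold) :
    ∀ (A : AbelianVariety ℂ) (φ : A ⟶ A) (d : ℕ), 0 < d → A.dim = 4 → φ ≫ φ = -(d • 𝟙 A) →
      (∀ c ∈ weilClassesOf A φ 2 d, IsOfHodgeType 4 A.X 4 2 2 c) →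
      A.IsSimple → (∃ ψ χ : A ⟶ A, ψ ≫ χ ≠ χ ≫ ψ) →
      ∀ N : ℕ, CMSpreadingAt (A.powSucc N) :=
  fun A φ d hd hA hφ hW hs hnc N ↦ cmSpreadingAt_of_hodgeConjectureFor (h A φ d hd hA hφ hW hs hnc N)

/-- **Cell (g) = E × Y(1,3) × powers.** Modulo `HC_CM` (binder) and #20, HC for the powers `(E × Y)^{N+1}`
(`N ≥ 1`) of MZ99 case (g) is EXACTLY the localised row U at those powers. [cite: Deligne1982HodgeCycles, §6 Prop. 6.1]
[cite: MoonenZarhin1999LowDim, Thm. 0.1 (4) case (g)] -/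
theorem hodgePowersOfEllipticTimesFourfold13_iff_cmSpreading_of_HC_CM (hCM : RankFourFaces.CMAbelianHodge)
    (hF : deligne1982_cmDenseMumfordTateFamilies) :
    Atlas.HodgePowersOfEllipticTimesFourfold13 ↔
      ∀ (E Y : AbelianVariety ℂ) (φ : E ⟶ E) (ψ : Y ⟶ Y) (d : ℕ), 0 < d → E.dim = 1 → Y.dim = 4 → Y.IsSimple →
        φ ≫ φ = -(d • 𝟙 E) → ψ ≫ ψ = -(d • 𝟙 Y) →
        (HodgeTheory.eigenMultiplicity Y ψ (Complex.I * (Real.sqrt d : ℂ)) = 1 ∨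
          HodgeTheory.eigenMultiplicity Y ψ (-(Complex.I * (Real.sqrt d : ℂ))) = 1) →
        ∀ N : ℕ, 0 < N → CMSpreadingAt ((E.prod Y).powSucc N) :=
  ⟨fun h E Y φ ψ d hd hE hY hs hφ hψ hm N hN ↦
      cmSpreadingAt_of_hodgeConjectureFor (h E Y φ ψ d hd hE hY hs hφ hψ hm N hN),
    fun h E Y φ ψ d hd hE hY hs hφ hψ hm N hN ↦
      hodgeConjectureFor_of_HC_CM_of_cmSpreadingAt hCM hF (h E Y φ ψ d hd hE hY hs hφ hψ hm N hN)⟩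

/-- ON-PATH, unconditionally: cell (g) gives the localised row U on its members. [cite: Deligne2000, §1] -/
theorem cmSpreading_of_hodgePowersOfEllipticTimesFourfold13 (h : Atlas.HodgePowersOfEllipticTimesFourfold13) :
    ∀ (E Y : AbelianVariety ℂ) (φ : E ⟶ E) (ψ : Y ⟶ Y) (d : ℕ), 0 < d → E.dim = 1 → Y.dim = 4 → Y.IsSimple →
      φ ≫ φ = -(d • 𝟙 E) → ψ ≫ ψ = -(d • 𝟙 Y) →
      (HodgeTheory.eigenMultiplicity Y ψ (Complex.I * (Real.sqrt d : ℂ)) = 1 ∨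
        HodgeTheory.eigenMultiplicity Y ψ (-(Complex.I * (Real.sqrt d : ℂ))) = 1) →
      ∀ N : ℕ, 0 < N → CMSpreadingAt ((E.prod Y).powSucc N) :=
  fun E Y φ ψ d hd hE hY hs hφ hψ hm N hN ↦ cmSpreadingAt_of_hodgeConjectureFor (h E Y φ ψ d hd hE hY hs hφ hψ hm N hN)

/-! ## §1′ Typer 1's class targets by name (`HCOnClass`, `HCAtDim`, `HCUpToDim`) -/

/-- **`HCOnClass 𝒞 ↔ CMSpreadingOn 𝒞` by name**, modulo `HC_CM` (binder) and #20 — part VII's per-class exactness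
glued to typer 1's `ClassTargets.HCOnClass`. [cite: Deligne1982HodgeCycles, §6 Prop. 6.1]
[cite: CharlesSchnell2014Notes, Thm. 11.5.11, Prop. 11.3.11] -/
theorem hcOnClass_iff_forall_cmSpreadingAt_of_HC_CM (hCM : RankFourFaces.CMAbelianHodge)
    (hF : deligne1982_cmDenseMumfordTateFamilies) (𝒞 : AbelianVariety ℂ → Prop) :
    ClassTargets.HCOnClass 𝒞 ↔ ∀ A : AbelianVariety ℂ, 𝒞 A → CMSpreadingAt A :=
  (ClassTargets.hcOnClass_iff 𝒞).trans (hcOnClass_iff_cmSpreadingOn_of_HC_CM hCM hF 𝒞)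

/-- ON-PATH by name, unconditionally: `HCOnClass 𝒞 →` localised row U on `𝒞`. [cite: Deligne2000, §1] -/
theorem forall_cmSpreadingAt_of_hcOnClass (𝒞 : AbelianVariety ℂ → Prop) (h : ClassTargets.HCOnClass 𝒞) :
    ∀ A : AbelianVariety ℂ, 𝒞 A → CMSpreadingAt A :=
  cmSpreadingOn_of_hcOnClass 𝒞 ((ClassTargets.hcOnClass_iff 𝒞).1 h)

/-- **Dimension row `g` by name**: `HCAtDim g ↔ (∀ A, A.dim = g → CMSpreadingAt A)` modulo `HC_CM` + #20.
[cite: CharlesSchnell2014Notes, Thm. 11.5.11] -/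
theorem hcAtDim_iff_forall_cmSpreadingAt_of_HC_CM (hCM : RankFourFaces.CMAbelianHodge)
    (hF : deligne1982_cmDenseMumfordTateFamilies) (g : ℕ) :
    ClassTargets.HCAtDim g ↔ ∀ A : AbelianVariety ℂ, A.dim = g → CMSpreadingAt A :=
  hcOnClass_iff_forall_cmSpreadingAt_of_HC_CM hCM hF _

/-- **Dimension `≤ g` by name**: `HCUpToDim g ↔ (∀ A, A.dim ≤ g → CMSpreadingAt A)` modulo `HC_CM` + #20.
[cite: CharlesSchnell2014Notes, Thm. 11.5.11] -/
theorem hcUpToDim_iff_forall_cmSpreadingAt_of_HC_CM (hCM : RankFourFaces.CMAbelianHodge)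
    (hF : deligne1982_cmDenseMumfordTateFamilies) (g : ℕ) :
    ClassTargets.HCUpToDim g ↔ ∀ A : AbelianVariety ℂ, A.dim ≤ g → CMSpreadingAt A :=
  hcOnClass_iff_forall_cmSpreadingAt_of_HC_CM hCM hF _

/-- **The known floor needs no input**: the localised row U holds on every abelian variety of dimension `≤ 3`
(typer 1's `hcUpToDim_three`, unconditional). [cite: MoonenZarhin1999LowDim, (2.3)] -/
theorem forall_cmSpreadingAt_of_dim_le_three : ∀ A : AbelianVariety ℂ, A.dim ≤ 3 → CMSpreadingAt A :=
  fun _ hA ↦ cmSpreadingAt_of_dim_le_three hA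

/-! ## §2 The discriminant-1 Weil sub-cell: the localised row U is a THEOREM modulo Floccari–Fu 2026 -/

/-- **Row U at every power of a discriminant-1 Weil-type fourfold, modulo the refereed named fact** (Floccari–Fu
2026 Thm. 1.2, binder `h5`; no `HC_CM`, no #20): the first cell of the atlas outside the CM / divisor-generated /
`dim ≤ 3` columns on which the deformation input is discharged. [cite: FloccariFu2026, Theorem 1.2] -/
theorem cmSpreadingAt_powSucc_discOneWeilFourfold_of_floccariFu
    (h5 : FloccariFu2026_hodgeClasses_algebraic_powers_discOneWeilFourfold) {d : ℕ} (hd : 0 < d)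
    (A : AbelianVariety ℂ) (φ : A ⟶ A) (hA : A.dim = 4) (hφ : φ ≫ φ = -(d • 𝟙 A))
    (e : ProjectiveEmbedding A.X) (a : complexBetti (projectiveSpace e.n ℂ) 2) (ha : IsRationalClass a) (ha0 : a ≠ 0)
    (hyp : IsHyperbolicWeilType A φ 2
      ((d : ℂ) • complexBetti.map e.ι 2 a + complexBetti.map φ.hom.hom.hom 2 (complexBetti.map e.ι 2 a)))
    (N : ℕ) : CMSpreadingAt (A.powSucc N) :=
  cmSpreadingAt_of_hodgeConjectureFor (hodgeConjectureFor_powSucc_of_floccariFu h5 hd A φ hA hφ e a ha ha0 hyp N)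

/-- The same in the sub-cell's own binder order (via the atlas's `hodgePowersOfDiscOneWeilFourfold_of_floccariFu`).
[cite: FloccariFu2026, Theorem 1.2] -/
theorem cmSpreading_discOneWeilFourfold_of_floccariFu
    (h5 : FloccariFu2026_hodgeClasses_algebraic_powers_discOneWeilFourfold) :
    ∀ (A : AbelianVariety ℂ) (φ : A ⟶ A) (d : ℕ), 0 < d → A.dim = 4 → φ ≫ φ = -(d • 𝟙 A) →
      ∀ (e : ProjectiveEmbedding A.X) (a : complexBetti (projectiveSpace e.n ℂ) 2), IsRationalClass a → a ≠ 0 →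
      IsHyperbolicWeilType A φ 2
        ((d : ℂ) • complexBetti.map e.ι 2 a + complexBetti.map φ.hom.hom.hom 2 (complexBetti.map e.ι 2 a)) →
      ∀ N : ℕ, CMSpreadingAt (A.powSucc N) :=
  fun A φ d hd hA hφ e a ha ha0 hyp N ↦
    cmSpreadingAt_of_hodgeConjectureFor (Atlas.hodgePowersOfDiscOneWeilFourfold_of_floccariFu h5 A φ d hd hA hφ e a ha ha0 hyp N)

/-! ## §3 Free CM anchors of the two `EXPECTED` cells of RING2-MAP D.34 (D.37) -/

/-- **Powers of one CM elliptic curve are FREE anchors**: the localised row U holds, WITHOUT `HC_CM`, at every abelian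
variety isogenous to `E^{N+1}`, `E` an elliptic curve with complex multiplication `φ`, `φ² = -d` (Tate / van Geemen
Thm. 4.3 + Lemma 3.7, the tree's `EllipticCurve.hodgeConjectureFor_of_isIsogenous_powSucc_of_cm`). These are the
`E_{k'}^6` fibres (dense) of the `k E₀` Weil `(2,1),(1,2)` families, `k'` the second imaginary quadratic subfield of
`k E₀` (RING2-MAP D.37 (b)). [cite: vanGeemen1994HodgeAV, Lemma 3.7 and Thm. 4.3] [cite: Abdulali2016TateTwists, Appendix A 3(b)] -/
theorem cmSpreadingAt_of_isIsogenous_powSucc_of_cm {E : AbelianVariety ℂ} (hE : E.dim = 1) (φ : E ⟶ E) {d : ℕ}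
    (hd : 0 < d) (hφ : φ ≫ φ = -(d • 𝟙 E)) (N : ℕ) {A : AbelianVariety ℂ} (hA : A.IsIsogenous (E.powSucc N)) :
    CMSpreadingAt A :=
  cmSpreadingAt_of_hodgeConjectureFor (EllipticCurve.hodgeConjectureFor_of_isIsogenous_powSucc_of_cm hE φ hd hφ N hA)

/-- **Powers of a simple abelian SURFACE are anchors modulo Tankeev–Ribet** (refereed named fact, prime `2`; no
`HC_CM`): HC holds at every abelian variety isogenous to `B^{N+1}`, `B` a simple complex abelian surface. With `B` of
CM type these are the `B²` fibres of the type III(1) Shimura curves at the cyclic / non-Galois quartic CM points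
(RING2-MAP D.37 (a)). [cite: MoonenZarhin1999LowDim, §2 Thm. (2.7)] [cite: vanGeemen1994HodgeAV, Lemma 3.7, Thm. 4.6] -/
theorem hodgeConjectureFor_of_isIsogenous_powSucc_simpleSurface_of_tankeevRibet
    (h : TankeevRibet1983_hodgeClasses_divisorial_powers_simplePrimeDimension) (B : AbelianVariety ℂ)
    (hB : B.dim = 2) (hs : B.IsSimple) (N : ℕ) {A : AbelianVariety ℂ} (hA : A.IsIsogenous (B.powSucc N)) :
    HodgeConjectureFor A.dim A.X :=
  HodgeConjectureFor.of_isIsogenous hA (hodgeConjectureFor_powSucc_of_tankeevRibet h B Nat.prime_two hB hs N)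

/-- … hence the localised row U holds there, modulo Tankeev–Ribet only. [cite: MoonenZarhin1999LowDim, §2 Thm. (2.7)] -/
theorem cmSpreadingAt_of_isIsogenous_powSucc_simpleSurface_of_tankeevRibet
    (h : TankeevRibet1983_hodgeClasses_divisorial_powers_simplePrimeDimension) (B : AbelianVariety ℂ)
    (hB : B.dim = 2) (hs : B.IsSimple) (N : ℕ) {A : AbelianVariety ℂ} (hA : A.IsIsogenous (B.powSucc N)) :
    CMSpreadingAt A :=
  cmSpreadingAt_of_hodgeConjectureFor (hodgeConjectureFor_of_isIsogenous_powSucc_simpleSurface_of_tankeevRibet h B hB hs N hA)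

variable {𝒳 S : SchemeOver ℂ}

/-- **Family form: a fibre charted by `A₀ ~ B^{N+1}`, `B` a simple abelian surface, lies in the ANCHOR LOCUS of part V**
(typer 2's `anchorLocus`), modulo Tankeev–Ribet and without `HC_CM` — the surface analogue of typer 2's
`mem_anchorLocus_of_chart_of_isIsogenous_powSucc_of_cm`. [cite: MoonenZarhin1999LowDim, §2 Thm. (2.7)]
[cite: vanGeemen1994HodgeAV, Lemma 3.7] -/
theorem mem_anchorLocus_of_chart_of_isIsogenous_powSucc_simpleSurface_of_tankeevRibet
    (h : TankeevRibet1983_hodgeClasses_divisorial_powers_simplePrimeDimension) {f : 𝒳 ⟶ S} {n : ℕ}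
    {s : ComplexPoints S} (A₀ : AbelianVariety ℂ) (e₀ : A₀.X ≅ fiberOver f s) (hdim : A₀.dim = n)
    (B : AbelianVariety ℂ) (hB : B.dim = 2) (hs : B.IsSimple) (N : ℕ) (hiso : A₀.IsIsogenous (B.powSucc N)) :
    s ∈ anchorLocus f n := by
  subst hdim
  exact mem_anchorLocus_of_chart e₀
    (hodgeConjectureFor_of_isIsogenous_powSucc_simpleSurface_of_tankeevRibet h B hB hs N hiso)

/-- **At an anchor fibre the localised row U to that fibre is tautological** (part VII's
`cmSpreadingTo_of_mem_anchorLocus`), so on a family all of whose CM fibres are charted by powers of one CM elliptic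
curve or of a simple CM surface, `HC_CM` is NOT used at the CM fibres: the cell is `U`-only there (KIND 1 of
RING2-MAP D.34/D.37). [cite: Deligne1982HodgeCycles, §6 Prop. 6.1] [cite: vanGeemen1994HodgeAV, Thm. 4.3] -/
theorem cmSpreadingTo_of_chart_of_isIsogenous_powSucc_of_cm {f : 𝒳 ⟶ S} {n : ℕ} {s : ComplexPoints S}
    (A₀ : AbelianVariety ℂ) (e₀ : A₀.X ≅ fiberOver f s) (hdim : A₀.dim = n) {E : AbelianVariety ℂ}
    (hE : E.dim = 1) (φ : E ⟶ E) {d : ℕ} (hd : 0 < d) (hφ : φ ≫ φ = -(d • 𝟙 E)) (N : ℕ)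
    (hiso : A₀.IsIsogenous (E.powSucc N)) : CMSpreadingTo f n s :=
  cmSpreadingTo_of_mem_anchorLocus
    (Hypotheses.mem_anchorLocus_of_chart_of_isIsogenous_powSucc_of_cm A₀ e₀ hdim hE φ hd hφ N hiso)

/-- Surface analogue, modulo Tankeev–Ribet. [cite: MoonenZarhin1999LowDim, §2 Thm. (2.7)] -/
theorem cmSpreadingTo_of_chart_of_isIsogenous_powSucc_simpleSurface_of_tankeevRibet
    (h : TankeevRibet1983_hodgeClasses_divisorial_powers_simplePrimeDimension) {f : 𝒳 ⟶ S} {n : ℕ}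
    {s : ComplexPoints S} (A₀ : AbelianVariety ℂ) (e₀ : A₀.X ≅ fiberOver f s) (hdim : A₀.dim = n)
    (B : AbelianVariety ℂ) (hB : B.dim = 2) (hs : B.IsSimple) (N : ℕ) (hiso : A₀.IsIsogenous (B.powSucc N)) :
    CMSpreadingTo f n s :=
  cmSpreadingTo_of_mem_anchorLocus
    (mem_anchorLocus_of_chart_of_isIsogenous_powSucc_simpleSurface_of_tankeevRibet h A₀ e₀ hdim B hB hs N hiso)

end Summit.HodgeConjecture.HodgeConjecture.Ring2.Deform
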